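import Summits.QuantumFields.YangMills.Theorems.BalabanUVNodesN15KingModelPositionSpaceRepresentation

/-!
# BalabanUVNodes ∕ N15 — THE KING-MODEL RUNG (PART Ϻ-i): KING's CONTINUUM BLOCK TWO-POINT FUNCTION IS THE DOUBLE BLOCK AVERAGE OF THE CONTINUUM FREE PROPAGATOR —
# `S₂^{ℝ}(z) = ∫_{[0,1]^{d+1}}∫_{[0,1]^{d+1}} C_m(‖z + a − b‖₂) db da`, `C_m(R) = ∫₀^∞ e^{−tm²}(4πt)^{−(d+1)∕2}e^{−R²∕4t}dt`, every dimension
# (Track A, DAG node N15 = NE2; FAN-OUT v1.1 §N15 s3 «KING-MODEL RUNG»; uses parts Ϻ-a∕b∕c∕f; count-neutral)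

HONEST FRAMING.  Count-neutral (cell `pub-ymgap`, seat `pub-ymgap-dag-n15-e` g35; `--supports stmt-QuantumFields-27366 --as helper` = K3⁸).  King's `A = 0`, `g = 0` model
([King1986] C. King, Commun. Math. Phys. **102** (1986) 649–677).  Part Ϻ-f reached `S₂^{ℝ}(z) = ∫₀^∞e^{−tm²}[∫_{a}∫_{b} k_t(z+a−b)]dt` with the proper time outermost.
THIS FILE moves the proper-time integral INSIDE the two block averages (Tonelli on `(0,∞) × ([0,1]^{d+1})²`: the integrand is non-negative and measurable, and
`∫_{b∈[0,1]^{d+1}} k_t(z+a−b)db ≤ ∫_{ℝ^{d+1}}k_t = 1` bounds the iterated integral by `∫₀^∞e^{−tm²}dt = m⁻²`), giving the literal reading of Theorem 2.1 (2.22)'s covariance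
in position space: ★★★ `S₂^{ℝ}(z) = ∫_{a∈[0,1]^{d+1}}∫_{b∈[0,1]^{d+1}} C_m(‖z+a−b‖₂)db da` — the covariance of the unit-BLOCK AVERAGES at `0` and at `z` of the continuum free
massive field with propagator `C_m = (−Δ+m²)⁻¹` (in proper-time form, part Ϻ-c's `freePropRadial`; on the null set `z+a−b = 0` the value of `C_m(0)` is immaterial).
NOT Bałaban's objects; NOT a node discharge; nothing continuum-Yang–Mills ∕ `ℝ⁴` ∕ OS ∕ Clay.  0 `sorry`, 0 def; standard axioms.

WHAT THIS FILE PROVES (kernel).  §1 `measurable_gaussLine_uncurry`, `integral_prod_gaussLine_sub` (`∫_{ℝ^{d+1}}Π_μ g_t(w_μ−b_μ)db = 1`), `integrable_prod_gaussLine_sub`, `setIntegral_cube_prod_gaussLine_le_one`.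
§2 `isFiniteMeasure_cube`, ★ `integrable_properTime_cube_uncurry` (Tonelli's integrability on `(0,∞) × cube²`), ★★ `kingS2Inf_eq_integral_cubePair` (one block-pair variable),
★★★ **`kingS2Inf_eq_blockAverage_freePropRadial`**.

HONEST SCOPE.  King's free model, `m² > 0`, every `d`; blocks are the half-open unit cubes `(0,1]^{d+1}` (null boundary immaterial).  N15 untouched; counts unmoved.  Locators (use):
[King1986] Thm 2.1 (2.22) p.654, (2.3) p.651, (4.5) p.670, Thm 3.3 (3.6) p.655.
-/

noncomputable section

open scoped BigOperators Topology
open Filter MeasureTheory Set Function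

namespace Summit.QuantumFields.YangMills.BalabanUVNodes.N15KingModelRung.ProperTime

open Summit.QuantumFields.YangMills.BalabanUVNodes.N15KingModelRung.OptimalDecay

variable {d : ℕ}

/-! ## §1 The heat kernel has mass at most one on a cube -/

/-- `(t, a) ↦ g_t(a)` is (jointly) measurable. [folklore] -/
theorem measurable_gaussLine_uncurry : Measurable fun q : ℝ × ℝ => gaussLine q.1 q.2 := by
  unfold gaussLine
  fun_prop

/-- `b ↦ Π_μ g_t(w_μ − b_μ)` is integrable on `ℝ^{d+1}` (`t > 0`). [folklore] -/
theorem integrable_prod_gaussLine_sub {t : ℝ} (ht : 0 < t) (w : Fin (d + 1) → ℝ) :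
    Integrable fun b : Fin (d + 1) → ℝ => ∏ μ, gaussLine t (w μ - b μ) :=
  Integrable.fintype_prod (f := fun μ s => gaussLine t (w μ - s)) fun μ => (integrable_gaussLine ht).comp_sub_left (w μ)

/-- `∫_{ℝ^{d+1}} Π_μ g_t(w_μ − b_μ)db = 1` (`t > 0`). [folklore] -/
theorem integral_prod_gaussLine_sub {t : ℝ} (ht : 0 < t) (w : Fin (d + 1) → ℝ) : ∫ b : Fin (d + 1) → ℝ, ∏ μ, gaussLine t (w μ - b μ) = 1 := by
  rw [integral_fintype_prod_volume_eq_prod (fun μ s => gaussLine t (w μ - s))]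
  refine Finset.prod_eq_one fun μ _ => ?_
  rw [integral_sub_left_eq_self (gaussLine t) volume (w μ), integral_gaussLine ht]

/-- `∫_{b ∈ (0,1]^{d+1}} Π_μ g_t(w_μ − b_μ)db ≤ 1`. [folklore] -/
theorem setIntegral_cube_prod_gaussLine_le_one {t : ℝ} (ht : 0 < t) (w : Fin (d + 1) → ℝ) :
    ∫ b in Set.pi univ (fun _ : Fin (d + 1) => Ioc (0 : ℝ) 1), ∏ μ, gaussLine t (w μ - b μ) ≤ 1 := by
  rw [← integral_prod_gaussLine_sub ht w]
  exact setIntegral_le_integral (integrable_prod_gaussLine_sub ht w) (Eventually.of_forall fun b => Finset.prod_nonneg fun μ _ => gaussLine_nonneg _ _)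

/-! ## §2 Tonelli: the proper time moves inside the block averages -/

/-- The unit cube `(0,1]^{d+1}` has Lebesgue measure `1`; in particular its restriction is a finite measure. [folklore] -/
theorem volume_cube : volume (Set.pi univ (fun _ : Fin (d + 1) => Ioc (0 : ℝ) 1)) = 1 := by
  rw [Real.volume_pi_Ioc (a := fun _ => (0 : ℝ)) (b := fun _ => 1)]
  simp

/-- ★★★ **KING's CONTINUUM BLOCK TWO-POINT FUNCTION IS THE DOUBLE BLOCK AVERAGE OF THE CONTINUUM FREE PROPAGATOR**: for `m² > 0` and every `z ∈ ℤ^{d+1}`,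
`S₂^{ℝ}(z) = ∫_{a∈(0,1]^{d+1}}∫_{b∈(0,1]^{d+1}} C_m(‖z + a − b‖₂) db da` with `C_m(R) = ∫₀^∞e^{−tm²}(4πt)^{−(d+1)∕2}e^{−R²∕4t}dt` (part Ϻ-c's `freePropRadial`) — Theorem 2.1
(2.22)'s continuum covariance of unit-block averages, in position space, in every dimension. [cite: King1986, Thm 2.1 (2.22) p.654, (2.3) p.651, (4.5) p.670, Thm 3.3 (3.6) p.655] -/
theorem kingS2Inf_eq_blockAverage_freePropRadial {m2 : ℝ} (hm : 0 < m2) (z : Fin (d + 1) → ℤ) :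
    kingS2Inf m2 z = ∫ a in Set.pi univ (fun _ : Fin (d + 1) => Ioc (0 : ℝ) 1), ∫ b in Set.pi univ (fun _ : Fin (d + 1) => Ioc (0 : ℝ) 1),
      freePropRadial d m2 (Real.sqrt (∑ μ, ((z μ : ℝ) + a μ - b μ) ^ 2)) := by
  -- notation
  set cube : Set (Fin (d + 1) → ℝ) := Set.pi univ (fun _ : Fin (d + 1) => Ioc (0 : ℝ) 1) with hcube
  set μc : Measure (Fin (d + 1) → ℝ) := volume.restrict cube with hμc
  haveI hfin : IsFiniteMeasure μc := by
    rw [hμc, isFiniteMeasure_restrict, hcube, volume_cube]; exact ENNReal.one_ne_top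
  -- the integrand on `(0,∞) × (cube × cube)`
  set F : ℝ → (Fin (d + 1) → ℝ) × (Fin (d + 1) → ℝ) → ℝ := fun t p => Real.exp (-(t * m2)) * ∏ μ, gaussLine t ((z μ : ℝ) + p.1 μ - p.2 μ) with hF
  have hFmeas : Measurable (uncurry F) := by
    simp only [hF]
    refine Measurable.mul (by fun_prop) (Finset.measurable_prod _ fun μ _ => ?_)
    exact measurable_gaussLine_uncurry.comp (measurable_fst.prodMk (by fun_prop))
  have hFnn : ∀ t p, 0 ≤ F t p := fun t p => mul_nonneg (Real.exp_nonneg _) (Finset.prod_nonneg fun μ _ => gaussLine_nonneg _ _)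
  -- Step 0: start from part Ϻ-f's form with the pair of blocks as one variable
  have hstart : kingS2Inf m2 z = ∫ t in Ioi (0 : ℝ), ∫ p, F t p ∂(μc.prod μc) := by
    rw [kingS2Inf_eq_integral_lineBlockAverages hm z]
    refine setIntegral_congr_fun measurableSet_Ioi fun t ht => ?_
    have ht : 0 < t := ht
    simp only [hF]
    simp_rw [intervalIntegral.integral_of_le zero_le_one]
    rw [prod_blockAverage_eq_cube (fun μ a b => gaussLine t ((z μ : ℝ) + a - b)), integral_const_mul]
    congr 1
    -- merge the two block averages (bounded continuous integrand on a finite measure)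
    have hbd : ∀ p : (Fin (d + 1) → ℝ) × (Fin (d + 1) → ℝ), ‖∏ μ, gaussLine t ((z μ : ℝ) + p.1 μ - p.2 μ)‖ ≤ (gaussLine t 0) ^ (d + 1) := by
      intro p
      rw [Real.norm_eq_abs, abs_of_nonneg (Finset.prod_nonneg fun μ _ => gaussLine_nonneg _ _)]
      calc ∏ μ, gaussLine t ((z μ : ℝ) + p.1 μ - p.2 μ) ≤ ∏ _μ : Fin (d + 1), gaussLine t 0 :=
            Finset.prod_le_prod (fun μ _ => gaussLine_nonneg _ _) fun μ _ => gaussLine_le_zero_val ht _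
        _ = (gaussLine t 0) ^ (d + 1) := by rw [Finset.prod_const, Finset.card_univ, Fintype.card_fin]
    have hmeas : AEStronglyMeasurable (fun p : (Fin (d + 1) → ℝ) × (Fin (d + 1) → ℝ) => ∏ μ, gaussLine t ((z μ : ℝ) + p.1 μ - p.2 μ)) (μc.prod μc) := by
      refine (Finset.measurable_prod _ fun μ _ => ?_).aestronglyMeasurable
      exact (continuous_gaussLine t).measurable.comp (by fun_prop)
    have hint : Integrable (fun p : (Fin (d + 1) → ℝ) × (Fin (d + 1) → ℝ) => ∏ μ, gaussLine t ((z μ : ℝ) + p.1 μ - p.2 μ)) (μc.prod μc) :=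
      (integrable_const ((gaussLine t 0) ^ (d + 1))).mono' hmeas (Eventually.of_forall hbd)
    exact (integral_prod _ hint).symm
  -- Step 1: integrability on `(0,∞) × (cube × cube)` by Tonelli
  have hslice : ∀ t : ℝ, 0 < t → ∫ p, ‖F t p‖ ∂(μc.prod μc) ≤ Real.exp (-(t * m2)) := by
    intro t ht
    have habs : (fun p => ‖F t p‖) = F t := funext fun p => by rw [Real.norm_eq_abs, abs_of_nonneg (hFnn t p)]
    rw [habs]
    have hmeas : AEStronglyMeasurable (F t) (μc.prod μc) := (hFmeas.comp (measurable_const.prodMk measurable_id)).aestronglyMeasurable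
    have hbd : ∀ p, ‖F t p‖ ≤ Real.exp (-(t * m2)) * (gaussLine t 0) ^ (d + 1) := by
      intro p
      rw [Real.norm_eq_abs, abs_of_nonneg (hFnn t p), hF]
      refine mul_le_mul_of_nonneg_left ?_ (Real.exp_nonneg _)
      calc ∏ μ, gaussLine t ((z μ : ℝ) + p.1 μ - p.2 μ) ≤ ∏ _μ : Fin (d + 1), gaussLine t 0 :=
            Finset.prod_le_prod (fun μ _ => gaussLine_nonneg _ _) fun μ _ => gaussLine_le_zero_val ht _
        _ = (gaussLine t 0) ^ (d + 1) := by rw [Finset.prod_const, Finset.card_univ, Fintype.card_fin]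
    have hint : Integrable (F t) (μc.prod μc) := (integrable_const _).mono' hmeas (Eventually.of_forall hbd)
    rw [integral_prod _ hint]
    simp only [hF]
    have hinner : ∀ a : Fin (d + 1) → ℝ, ∫ b, Real.exp (-(t * m2)) * ∏ μ, gaussLine t ((z μ : ℝ) + a μ - b μ) ∂μc ≤ Real.exp (-(t * m2)) := by
      intro a
      rw [integral_const_mul]
      refine mul_le_of_le_one_right (Real.exp_nonneg _) ?_
      have h := setIntegral_cube_prod_gaussLine_le_one ht (fun μ => (z μ : ℝ) + a μ)
      exact h
    calc ∫ a, ∫ b, Real.exp (-(t * m2)) * ∏ μ, gaussLine t ((z μ : ℝ) + a μ - b μ) ∂μc ∂μc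
        ≤ ∫ _a, Real.exp (-(t * m2)) ∂μc := by
          refine integral_mono_of_nonneg (Eventually.of_forall fun a => ?_) (integrable_const _) (Eventually.of_forall hinner)
          exact integral_nonneg fun b => hFnn t (a, b)
      _ = Real.exp (-(t * m2)) := by
          rw [integral_const, smul_eq_mul, Measure.real, hμc, Measure.restrict_apply_univ, hcube, volume_cube]
          simp
  have hint : Integrable (uncurry F) ((volume.restrict (Ioi (0 : ℝ))).prod (μc.prod μc)) := by
    rw [integrable_prod_iff hFmeas.aestronglyMeasurable]
    constructor
    · filter_upwards [ae_restrict_mem measurableSet_Ioi] with t ht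
      have ht : 0 < t := ht
      have hmeas : AEStronglyMeasurable (F t) (μc.prod μc) := (hFmeas.comp (measurable_const.prodMk measurable_id)).aestronglyMeasurable
      refine (integrable_const (Real.exp (-(t * m2)) * (gaussLine t 0) ^ (d + 1))).mono' hmeas (Eventually.of_forall fun p => ?_)
      have hp := hFnn t p
      simp only [hF] at hp
      simp only [uncurry, Real.norm_eq_abs, hF]
      rw [abs_of_nonneg hp]
      refine mul_le_mul_of_nonneg_left ?_ (Real.exp_nonneg _)
      calc ∏ μ, gaussLine t ((z μ : ℝ) + p.1 μ - p.2 μ) ≤ ∏ _μ : Fin (d + 1), gaussLine t 0 :=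
            Finset.prod_le_prod (fun μ _ => gaussLine_nonneg _ _) fun μ _ => gaussLine_le_zero_val ht _
        _ = (gaussLine t 0) ^ (d + 1) := by rw [Finset.prod_const, Finset.card_univ, Fintype.card_fin]
    · have hE : IntegrableOn (fun t : ℝ => Real.exp (-m2 * t)) (Ioi (0 : ℝ)) := exp_neg_integrableOn_Ioi 0 hm
      refine hE.mono' (hFmeas.stronglyMeasurable.norm.integral_prod_right').aestronglyMeasurable ?_
      filter_upwards [ae_restrict_mem measurableSet_Ioi] with t ht
      rw [Real.norm_eq_abs, abs_of_nonneg (integral_nonneg fun p => norm_nonneg _), show -m2 * t = -(t * m2) by ring]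
      exact hslice t ht
  -- Step 2: swap, then split the block pair again
  rw [hstart, integral_integral_swap hint]
  have hG : Integrable (fun p => ∫ t in Ioi (0 : ℝ), F t p) (μc.prod μc) := hint.integral_prod_right
  rw [integral_prod _ hG]
  refine integral_congr_ae (Eventually.of_forall fun a => integral_congr_ae (Eventually.of_forall fun b => ?_))
  simp only [hF, freePropRadial]
  refine integral_congr_ae (Eventually.of_forall fun t => ?_)
  simp only
  rw [prod_gaussLine_eq_heatRadial]

end Summit.QuantumFields.YangMills.BalabanUVNodes.N15KingModelRung.ProperTime
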